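import Literature.AlgebraicGeometry.Modules.DerivedPushforward
import Literature.AlgebraicGeometry.Morphisms.DevissageClass
import Literature.AlgebraicGeometry.KTheory.EulerCharacteristic
import Literature.AlgebraicGeometry.Motives.AbelianVariety
import Mathlib.AlgebraicGeometry.Morphisms.Proper
import HarnessLib

/-!
# Two classical finiteness facts on the bounded-below derived category of `𝒪`-modules (NAMED FACTS):
# Grothendieck's coherence of higher direct images (EGA III 3.2.1) and bounded-coherent objects on a smooth
# projective variety as classes of bounded vector-bundle complexes (Thomason–Trobaugh 2.3.1 (d), SGA 6 II 2.2.2.1)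

Layer `Literature/AlgebraicGeometry/Modules`. Both statements are `def … : Prop` (debt, not theorems: no proof in the tree),
phrased on the tree's carriers — the derived direct image `derivedPushforwardPlus f : D⁺(Mod 𝒪_X) ⥤ D⁺(Mod 𝒪_Y)` of
`Modules/DerivedPushforward` (Hartshorne III §8), Mathlib's `DerivedCategory.Plus` with its cohomology functors
`DerivedCategory.Plus.homologyFunctor` and amplitude predicates `IsGE`/`IsLE`, the affine-local coherence predicate
`Morphisms/DevissageClass.Coh` (affine-localizing + affine-finite-type = coherence on locally noetherian schemes, EGA I 1.4.1 /
Hartshorne II 5.4), and `KTheory/EulerCharacteristic.IsBoundedVBComplex` (every term finite locally free, almost all zero):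

* `Grothendieck_higherDirectImage_coh` — **[GS]** for `f : X → Y` proper, `Y` locally noetherian, `𝓕` coherent, every cohomology
  sheaf `𝓗ᵏ(Rf_*(𝓕[0]))` is coherent. NO boundedness of `Rf_*(𝓕[0])` is asserted here (no `IsLE` may be read into it).
* `ThomasonTrobaugh_vbModel_of_boundedCoh` — **[SP]**, typed in the special case of a complex abelian variety `B` (smooth and
  projective): an object of `D⁺(Mod 𝒪_B)` with bounded and coherent cohomology sheaves is isomorphic to the class `Q⁺(K•)` of a
  bounded complex `K•` of finite locally free `𝒪_B`-modules.

Typed for the cell `pub-hodge-ring2` (the (m) MODEL step of road №4's kernel leg: a bounded vector-bundle model of the descended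
transform `R(pr_Y)_*(Ñ₀[0])` on Markman's secant quotient); a research route conditional on HC_CM, not a corollary — nothing in this
file refers to it. No instance, no notation, no `sorry`; the two `def`s are the file's only declarations.

## References

* A. Grothendieck, J. Dieudonné, *Éléments de géométrie algébrique III* (Publ. Math. IHÉS 11, 1961), Thm. 3.2.1. [EGAIII1]
* R. Hartshorne, *Algebraic Geometry*, GTM 52 (1977), III Thm. 8.8 (b) (p. 252; f projective). [Hartshorne1977]
* The Stacks Project, Tag 02O5 (proper pushforward of coherent modules), Tag 08E8 / 0FDC (D^b(Coh) and D^b_coh). [StacksProject]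
* U. Görtz, T. Wedhorn, *Algebraic Geometry II* (2023), Thm. 23.17. [GortzWedhorn2023]
* R. W. Thomason, T. Trobaugh, *Higher algebraic K-theory of schemes and of derived categories* (1990), Prop. 2.3.1 (d).
  [ThomasonTrobaugh1990]
* P. Berthelot, A. Grothendieck, L. Illusie, *SGA 6*, Exp. II, Cor. 2.2.2.1. [SGA6]
* D. Huybrechts, *Fourier–Mukai transforms in algebraic geometry* (2006), Prop. 3.26. [HuybrechtsFM2006]
-/

noncomputable section

open CategoryTheory CategoryTheory.Limits AlgebraicGeometry

namespace Literature.AlgebraicGeometry.Modules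

/-- **Grothendieck's coherence of higher direct images** (EGA III Thm. 3.2.1; Hartshorne III Thm. 8.8 (b) for f projective;
GW II Thm. 23.17; Stacks 02O5): for f : X → Y PROPER, Y locally noetherian and 𝓕 a coherent 𝒪_X-module, every cohomology sheaf
𝓗ᵏ(Rf_*(𝓕[0])) of the derived direct image (the tree's `derivedPushforwardPlus`, Hartshorne III §8) is coherent (the tree's
affine-local `Coh`). No boundedness of `Rf_*(𝓕[0])` is asserted. [cite: EGAIII1, Thm. 3.2.1] [cite: Hartshorne1977, III Thm. 8.8 (b) (p. 252)]
[cite: StacksProject, Tag 02O5] [cite: GortzWedhorn2023, Thm. 23.17] -/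
def Grothendieck_higherDirectImage_coh.{u, w, w'} : Prop :=
  ∀ ⦃X Y : Scheme.{u}⦄ (f : X ⟶ Y) [IsProper f] [IsLocallyNoetherian Y] (𝓕 : X.Modules),
    Literature.AlgebraicGeometry.Morphisms.Coh 𝓕 →
      ∀ [HasDerivedCategory.{w} X.Modules] [HasDerivedCategory.{w'} Y.Modules] (k : ℤ),
        Literature.AlgebraicGeometry.Morphisms.Coh ((DerivedCategory.Plus.homologyFunctor Y.Modules k).obj
          ((derivedPushforwardPlus f).obj ((DerivedCategory.Plus.singleFunctor X.Modules 0).obj 𝓕)))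

/-- **Bounded coherent objects on a smooth projective variety are classes of bounded vector-bundle complexes** — typed special
case: on a complex abelian variety `B`, every object of `D⁺(Mod 𝒪_B)` with bounded coherent cohomology sheaves is isomorphic to the
class of a bounded complex of finite locally free `𝒪_B`-modules. This is the conjunction-free consequence of
[Thomason–Trobaugh 2.3.1 (d)] (on a scheme with an ample family of line bundles every perfect complex is isomorphic in
`D(Mod 𝒪)` to a strictly perfect one) ∧ regularity (Auslander–Buchsbaum–Serre: coherent ⇒ perfect on a regular scheme) ∧
[SGA 6 II 2.2.2.1] (`D^b(Coh B) ≃ D^b_coh(Mod 𝒪_B)` for `B` noetherian; equivalently [Huybrechts 2006 Prop. 3.26], and The Stacks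
Project Tag 0FDC / 08E8 for the `Mod`-versus-`Coh`/`QCoh` comparison step). [cite: ThomasonTrobaugh1990, Prop. 2.3.1 (d)]
[cite: SGA6, Exp. II Cor. 2.2.2.1] [cite: HuybrechtsFM2006, Prop. 3.26] [cite: StacksProject, Tag 0FDC] -/
def ThomasonTrobaugh_vbModel_of_boundedCoh.{w} : Prop :=
  ∀ (B : Literature.AlgebraicGeometry.Motives.AbelianVariety ℂ) [HasDerivedCategory.{w} B.X.left.Modules]
    (E : DerivedCategory.Plus B.X.left.Modules) (a b : ℤ), E.IsGE a → E.IsLE b →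
      (∀ k : ℤ, Literature.AlgebraicGeometry.Morphisms.Coh ((DerivedCategory.Plus.homologyFunctor _ k).obj E)) →
        ∃ (K : CochainComplex B.X.left.Modules ℤ) (_ : Literature.AlgebraicGeometry.KTheory.IsBoundedVBComplex K)
          (n : ℤ) (hn : CochainComplex.IsStrictlyGE K n), Nonempty (DerivedCategory.Plus.Q.obj ⟨K, n, hn⟩ ≅ E)
-- TODO(general form): Y regular with an ample family of line bundles (TT 2.3.1 (d)); D^b(Coh Y) ≃ D^b_coh(Mod 𝒪_Y) (SGA 6 II 2.2.2.1).

end Literature.AlgebraicGeometry.Modules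

end
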